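import Mathlib
import Summits.Ventures.PercRepro2.Defs
import Summits.Ventures.PercRepro2.Harris
import Summits.Ventures.PercRepro2.Switching
import Summits.Ventures.PercRepro2.EdgeInduction
import Summits.Ventures.PercRepro2.Bernstein

/-!
# Pattern coefficients as interval counts; the pinned switching inequality (blind cell PercRepro2, mine-1)

The ordered pairs `(ω, ω')` with meet `m` and join `j` are exactly the pairs `(ω, ω̄)` with
`m ≤ ω ≤ j` and `ω̄ = m ⊔ (j ⊓ ωᶜ)` (the "complement of `ω` inside the pattern": the edges of `m`
are open in both, the edges outside `j` closed in both, and the edges of `j ∖ m` are switched).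
Hence the pattern coefficient is a difference of two counts over the interval `[m, j]`, and
pattern positivity is a family of *pinned switching inequalities* on the graph itself:

  `#{ω ∈ [m,j] : ω ∈ (A∘B)∩C, ω̄ ∈ C} ≤ #{ω ∈ [m,j] : ω ∈ A∩C, ω̄ ∈ B∩C}`   (R13-comb with pinned edges).

For `m = ⊥`, `j = ⊤` this is typer-1's `R13Comb` (`ω̄ = ωᶜ`); the general case is the statement on
the contraction `G/m − jᶜ` transported back to `G` (`R13-STATEMENT.md` Theorem 2.3), so that R13
for all weights follows from the pinned switching inequalities for all `m ≤ j` (formal chain: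
`R13_of_pinnedSwitching` below, via `Bernstein.lean` and `EdgeInduction.lean`).
-/

namespace Summit.Ventures.PercRepro2

section PatternCount

variable {E : Type*} [Fintype E] [DecidableEq E] {R : Type*} [CommRing R]

open Classical in
/-- The interval `[m, j]` of configurations, as a finset. -/
noncomputable def patternInterval (m j : Config E) : Finset (Config E) :=
  Finset.univ.filter fun ω => m ≤ ω ∧ ω ≤ j

open Classical in
/-- Membership in the interval `[m, j]`. -/
lemma mem_patternInterval {m j ω : Config E} : ω ∈ patternInterval m j ↔ m ≤ ω ∧ ω ≤ j := by
  simp [patternInterval]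

/-- The complement of `ω` inside the pattern `(m, j)`: `m ⊔ (j ⊓ ωᶜ)`. -/
def patternCompl (m j ω : Config E) : Config E := m ⊔ (j ⊓ ωᶜ)

omit [Fintype E] [DecidableEq E] in
/-- The pattern complement edge by edge: open iff `e ∈ m`, or `e ∈ j` and `e ∉ ω`. -/
lemma patternCompl_apply (m j ω : Config E) (e : E) :
    patternCompl m j ω e = (m e || (j e && !ω e)) := rfl

omit [Fintype E] [DecidableEq E] in
/-- For `m ≤ ω ≤ j`, the pair `(ω, ω̄)` has meet `m` and join `j`. -/
lemma inf_patternCompl {m j ω : Config E} (hm : m ≤ ω) (hj : ω ≤ j) :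
    ω ⊓ patternCompl m j ω = m := by
  funext e
  have hme := hm e
  have hje := hj e
  simp only [Pi.inf_apply, patternCompl_apply]
  revert hme hje
  cases m e <;> cases j e <;> cases ω e <;> simp

omit [Fintype E] [DecidableEq E] in
/-- For `m ≤ ω ≤ j`, the join of `ω` and its pattern complement is `j`. -/
lemma sup_patternCompl {m j ω : Config E} (hm : m ≤ ω) (hj : ω ≤ j) :
    ω ⊔ patternCompl m j ω = j := by
  funext e
  have hme := hm e
  have hje := hj e
  simp only [Pi.sup_apply, patternCompl_apply]
  revert hme hje
  cases m e <;> cases j e <;> cases ω e <;> simp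

omit [Fintype E] [DecidableEq E] in
/-- Conversely, a pair with meet `m` and join `j` is `(ω, ω̄)` with `m ≤ ω ≤ j`. -/
lemma eq_patternCompl_of_inf_sup {m j ω ω' : Config E} (h1 : ω ⊓ ω' = m) (h2 : ω ⊔ ω' = j) :
    ω' = patternCompl m j ω := by
  subst h1 h2
  funext e
  simp only [Pi.inf_apply, Pi.sup_apply, patternCompl_apply]
  cases ω e <;> cases ω' e <;> simp

omit [Fintype E] [DecidableEq E] in
/-- The meet of a pair bounds each member from below. -/
lemma le_of_inf_eq {m ω ω' : Config E} (h : ω ⊓ ω' = m) : m ≤ ω := by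
  subst h; exact inf_le_left

omit [Fintype E] [DecidableEq E] in
/-- The join of a pair bounds each member from above. -/
lemma le_of_sup_eq {j ω ω' : Config E} (h : ω ⊔ ω' = j) : ω ≤ j := by
  subst h; exact le_sup_left

open Classical in
/-- **The pattern coefficient as an interval sum**: `c(m,j) = ∑_{m ≤ ω ≤ j} pairTerm ω ω̄`. -/
theorem patternCoeff_eq_sum_Icc (F G H K : Set (Config E)) (m j : Config E) :
    (patternCoeff F G H K (m, j) : R)
      = ∑ ω ∈ patternInterval m j, (pairTerm F G H K ω (patternCompl m j ω) : R) := by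
  unfold patternCoeff
  rw [← Finset.sum_filter]
  refine Finset.sum_nbij' (fun x => x.1) (fun ω => (ω, patternCompl m j ω)) ?_ ?_ ?_ ?_ ?_
  · intro x hx
    simp only [Finset.mem_filter, Finset.mem_univ, true_and, Prod.mk.injEq] at hx
    exact mem_patternInterval.2 ⟨le_of_inf_eq hx.1, le_of_sup_eq hx.2⟩
  · intro ω hω
    have h := mem_patternInterval.1 hω
    simp only [Finset.mem_filter, Finset.mem_univ, true_and, Prod.mk.injEq]
    exact ⟨inf_patternCompl h.1 h.2, sup_patternCompl h.1 h.2⟩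
  · intro x hx
    simp only [Finset.mem_filter, Finset.mem_univ, true_and, Prod.mk.injEq] at hx
    exact Prod.ext rfl (eq_patternCompl_of_inf_sup hx.1 hx.2).symm
  · intro ω _
    rfl
  · intro x hx
    simp only [Finset.mem_filter, Finset.mem_univ, true_and, Prod.mk.injEq] at hx
    rw [← eq_patternCompl_of_inf_sup hx.1 hx.2]

open Classical in
/-- The two interval counts: `ℛ_{m,j}` (pairs in `F × G`) and `ℒ_{m,j}` (pairs in `H × K`). -/
theorem patternCoeff_eq_card_sub_card (F G H K : Set (Config E)) (m j : Config E) :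
    (patternCoeff F G H K (m, j) : R)
      = (((patternInterval m j).filter fun ω => ω ∈ F ∧ patternCompl m j ω ∈ G).card : R)
        - (((patternInterval m j).filter fun ω => ω ∈ H ∧ patternCompl m j ω ∈ K).card : R) := by
  rw [patternCoeff_eq_sum_Icc]
  unfold pairTerm
  rw [Finset.sum_sub_distrib]
  congr 1
  · rw [Finset.card_filter, Nat.cast_sum]
    refine Finset.sum_congr rfl fun ω _ => ?_
    by_cases hF : ω ∈ F <;> by_cases hG : patternCompl m j ω ∈ G <;> simp [hF, hG]
  · rw [Finset.card_filter, Nat.cast_sum]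
    refine Finset.sum_congr rfl fun ω _ => ?_
    by_cases hH : ω ∈ H <;> by_cases hK : patternCompl m j ω ∈ K <;> simp [hH, hK]

end PatternCount

section R13Pinned

variable {V : Type*} {E : Type*} [Fintype E] [DecidableEq E]

open Classical in
/-- `ℒ_{m,j}`: configurations `ω ∈ [m, j]` in `(A∘B) ∩ C` whose pattern complement lies in `C`. -/
noncomputable def pinnedSwitchingL (ends : E → Sym2 V) (s t a b : V) (m j : Config E) :
    Finset (Config E) :=
  (patternInterval m j).filter fun ω =>
    ω ∈ disjointConnEvent ends s a b ∩ connEvent ends s t ∧ patternCompl m j ω ∈ connEvent ends s t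

open Classical in
/-- `ℛ_{m,j}`: configurations `ω ∈ [m, j]` in `A ∩ C` whose pattern complement lies in `B ∩ C`. -/
noncomputable def pinnedSwitchingR (ends : E → Sym2 V) (s t a b : V) (m j : Config E) :
    Finset (Config E) :=
  (patternInterval m j).filter fun ω =>
    ω ∈ connEvent ends s a ∩ connEvent ends s t ∧
      patternCompl m j ω ∈ connEvent ends s b ∩ connEvent ends s t

/-- **The pinned switching inequality** `|ℒ_{m,j}| ≤ |ℛ_{m,j}|` for every pattern `m ≤ j`
(R13-comb on `G` with the edges of `m` forced open and those outside `j` forced closed). -/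
def R13PinnedSwitching (ends : E → Sym2 V) (s t a b : V) : Prop :=
  ∀ m j : Config E, (pinnedSwitchingL ends s t a b m j).card ≤ (pinnedSwitchingR ends s t a b m j).card

variable {R : Type*} [CommRing R] [PartialOrder R] [IsOrderedRing R]

/-- **R13 from the pinned switching inequalities** (formal chain of `R13-STATEMENT.md`
Lemma 2.1 / Corollary 2.2): `R13PinnedSwitching ends s t a b → R13 p ends s t a b` for every
admissible `p`. -/
theorem R13_of_pinnedSwitching {p : E → R} (hp : IsProbVec p) (ends : E → Sym2 V) (s t a b : V)
    (h : R13PinnedSwitching ends s t a b) : R13 p ends s t a b := by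
  classical
  refine R13_of_patternCoeff_nonneg hp ends s t a b fun mj => ?_
  obtain ⟨m, j⟩ := mj
  unfold R13PatternCoeff
  rw [patternCoeff_eq_card_sub_card, sub_nonneg]
  have hmj : ((pinnedSwitchingL ends s t a b m j).card : R)
      ≤ ((pinnedSwitchingR ends s t a b m j).card : R) := Nat.mono_cast (h m j)
  unfold pinnedSwitchingL pinnedSwitchingR at hmj
  convert hmj using 3 <;> congr

end R13Pinned

end Summit.Ventures.PercRepro2
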